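import Summits.QuantumFields.GaugeBoot.PairLoopClasses
import HarnessLib

/-!
# Gauge-boot: reflection-positivity blocks for families of WORDS (site reflection)

Cell `pub-gaugeboot` (HOME `run/shared/lean/pub/pub-gaugeboot/`), seat lean1 (words / symmetry / Gram / bindings).
The Class-A positivity families of the ladder certificates (TRUNCATIONS.md, RP-INSTANCES.md; eng1 `emit.py
block_matrices`, eng2 `pos/blocks.py`) are: the Hermitian Gram block `H` (tree-level for words:
`WordLoop.sum_mul_wilsonExpectation_wordLoop_nonneg`) and the REFLECTION blocks `site1` / `link1` on the words of the
closed positive half-space. This file proves the SITE block for an arbitrary finite family of words: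

* `Word.siteHalfOK B w y` (Boolean, `decide`): read from the integer site `y`, every link of `w` lies in the closed
  positive half `0 ≤ x₀ ≤ B`, temporal links strictly below height `B`;
* `edge_mem_of_siteHalfOK`: on the torus `(ℤ/L)^d` with `2B ≤ L` these links are positive-or-shared links of the
  tree's site reflection (`WilsonSiteRP.sitePosEdges ∪ sharedEdges`), so word holonomies read from the origin are
  observables of the closed positive half (`dependsOn_wordHolonomy`);
* **`sum_mul_wilsonExpectation_wordLoop_reflect0_nonneg`**: for `L` even, ANY real `β`, closed words `R₁ … Rₙ` at the
  origin with `siteHalfOK B Rᵢ 0`, `2B ≤ L`, and real `cᵢ`,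
  `0 ≤ ∑ᵢⱼ cᵢ cⱼ ⟨W_0((θ'Rᵢ)⁻¹ · Rⱼ)⟩_β`, `θ' = Step.reflect0` (`a ↔ A`) — i.e. eng1's `site1` matrix
  `[canonical_loop(inverse(xflip(R_a)) + R_b)]_{ab}` is positive semi-definite IN EXPECTATION on every even torus.
  Proof: the tree's Osterwalder–Seiler site reflection positivity `wilsonExpectation_siteReflectionPositive` applied to
  the matrix entries `F^{kl} = ∑ⱼ cⱼ σ(hol_0(Rⱼ))_{kl}` of the unitarised representation, `hol_0(R)(Θ'U) = hol_0(θ'R)(U)`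
  (`wordHolonomy_negReflect`), and `∑_{kl} conj σ(A)_{kl} σ(B)_{kl} = tr σ(A⁻¹B)`.

HONEST FRAMING (page 1 of every file of this cell): certified bounds on lattice expectations at STATED coupling,
gauge group, dimension and torus size; NOT a mass gap, NOT a continuum limit, NOT a string tension, NOT large `N`.
The venture is explicitly NOT Yang–Mills-summit-bearing (barriers `FixedCouplingUltralocality`,
`PerturbativeInvisibility`). The link-reflection block (crossing links; tree `wilsonExpectation_nonneg_of_covariant`)
is NOT in this file.
-/

noncomputable section

open MeasureTheory ComplexConjugate
open scoped ComplexOrder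
open Literature.MathematicalPhysics.QuantumFieldTheory
open Literature.RepresentationTheory.CompactGroups

namespace Summit.QuantumFields.GaugeBoot

/-! ## The closed positive half-space condition on words (integer geometry, decidable) -/

namespace Word

variable {d : ℕ} [NeZero d]

/-- The link used by the step `s` from the integer site `y` lies in the closed positive half of height `B`:
spatial links at heights `0 ≤ y₀ ≤ B`, temporal links between heights `0 … B`. [folklore] -/
def stepSiteOK (B : ℕ) (y : Fin d → ℤ) : Step d → Bool
  | .fwd μ => if μ = 0 then decide (0 ≤ y 0 ∧ y 0 + 1 ≤ B) else decide (0 ≤ y 0 ∧ y 0 ≤ B)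
  | .bwd μ => if μ = 0 then decide (1 ≤ y 0 ∧ y 0 ≤ B) else decide (0 ≤ y 0 ∧ y 0 ≤ B)

/-- Every link of the word `w` read from the integer site `y` lies in the closed positive half of height `B`.
[folklore] -/
def siteHalfOK (B : ℕ) : Word d → (Fin d → ℤ) → Bool
  | [], _ => true
  | s :: w, y => stepSiteOK B y s && siteHalfOK B w (y + s.disp)

end Word

/-! ## Torus geometry of integer sites of small height -/

section Geometry

variable {d L : ℕ} [NeZero d] [NeZero L]

/-- The time coordinate of `y mod L` for `0 ≤ y₀ < L`. [folklore] -/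
theorem val_castZ_zero {y : Fin d → ℤ} (h0 : 0 ≤ y 0) (hL : y 0 < L) :
    (((castZ y : Site d L) 0).val : ℤ) = y 0 := by
  rw [show (castZ y : Site d L) 0 = ((y 0 : ℤ) : ZMod L) from rfl, ZMod.val_intCast, Int.emod_eq_of_lt h0 hL]

open WilsonSiteRP in
/-- **A link of the closed positive half (integer condition) is a positive-or-shared link of the site
reflection** on every torus with `2B ≤ L`. [folklore] -/
theorem edge_mem_of_stepSiteOK {B : ℕ} (hB : 2 * B ≤ L) {y : Fin d → ℤ} {s : Step d}
    (h : Word.stepSiteOK B y s = true) :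
    s.edge (castZ y : Site d L) ∈ (sitePosEdges ∪ sharedEdges : Finset (Edge d L)) := by
  have hL2 : (B : ℤ) ≤ (L / 2 : ℕ) := by exact_mod_cast (by omega : B ≤ L / 2)
  have hLB : (B : ℤ) < L := by exact_mod_cast (by have := NeZero.ne L; omega : B < L)
  rw [Finset.mem_union, mem_sitePosEdges, mem_sharedEdges]
  cases s with
  | fwd μ =>
    by_cases hμ : μ = 0
    · subst hμ
      simp only [Word.stepSiteOK, ↓reduceIte, decide_eq_true_eq] at h
      left
      simp only [Step.edge_fwd, IsSitePosEdge, ↓reduceIte]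
      have hv := val_castZ_zero (d := d) (L := L) h.1 (by omega)
      omega
    · simp only [Word.stepSiteOK, hμ, ↓reduceIte, decide_eq_true_eq] at h
      simp only [Step.edge_fwd, IsSitePosEdge, hμ, ↓reduceIte, IsSharedEdge, ne_eq, not_false_eq_true, true_and]
      have hv := val_castZ_zero (d := d) (L := L) h.1 (by omega)
      omega
  | bwd μ =>
    have hbase : (castZ y : Site d L) - Pi.single μ 1 = castZ (y - Pi.single μ 1) := by
      rw [sub_eq_add_neg, sub_eq_add_neg, castZ_add, castZ_neg, castZ_single]
    by_cases hμ : μ = 0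
    · subst hμ
      simp only [Word.stepSiteOK, ↓reduceIte, decide_eq_true_eq] at h
      left
      simp only [Step.edge_bwd, hbase, IsSitePosEdge, ↓reduceIte]
      have hv := val_castZ_zero (d := d) (L := L) (y := y - Pi.single 0 1) (by simp; omega) (by simp; omega)
      simp only [Pi.sub_apply, Pi.single_eq_same] at hv
      omega
    · simp only [Word.stepSiteOK, hμ, ↓reduceIte, decide_eq_true_eq] at h
      simp only [Step.edge_bwd, hbase, IsSitePosEdge, hμ, ↓reduceIte, IsSharedEdge, ne_eq, not_false_eq_true,
        true_and]
      have hv := val_castZ_zero (d := d) (L := L) (y := y - Pi.single μ 1)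
        (by simp [Pi.single_eq_of_ne (Ne.symm hμ)]; omega) (by simp [Pi.single_eq_of_ne (Ne.symm hμ)]; omega)
      simp only [Pi.sub_apply, Pi.single_eq_of_ne (Ne.symm hμ), sub_zero] at hv
      omega

open WilsonSiteRP in
/-- **All links of a half-space word are positive-or-shared links.** [folklore] -/
theorem edge_mem_of_siteHalfOK {B : ℕ} (hB : 2 * B ≤ L) :
    ∀ (w : Word d) (y : Fin d → ℤ), Word.siteHalfOK B w y = true →
      ∀ (k : ℕ) (hk : k < w.length),
        (w.get ⟨k, hk⟩).edge (Word.siteAt (castZ y : Site d L) w k) ∈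
          (sitePosEdges ∪ sharedEdges : Finset (Edge d L))
  | [], _, _, k, hk => by simp at hk
  | s :: w, y, h, 0, _ => by
    simp only [Word.siteHalfOK, Bool.and_eq_true] at h
    simpa using edge_mem_of_stepSiteOK (d := d) (L := L) hB h.1
  | s :: w, y, h, k + 1, hk => by
    simp only [Word.siteHalfOK, Bool.and_eq_true] at h
    have ih := edge_mem_of_siteHalfOK hB w (y + s.disp) h.2 k (by simpa using hk)
    simpa [Word.siteAt_succ_cons, ← castZ_add_disp] using ih

end Geometry

/-! ## Observables of the closed positive half built from word holonomies -/

section Support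

variable {d L : ℕ} {G : Type*} [Group G]

/-- A function of the holonomy of a word depends only on the links the word traverses. [folklore] -/
theorem dependsOn_wordHolonomy {α : Type*} (f : G → α) (x : Site d L) (w : Word d) (S : Set (Edge d L))
    (h : ∀ (k : ℕ) (hk : k < w.length), (w.get ⟨k, hk⟩).edge (Word.siteAt x w k) ∈ S) :
    DependsOn (fun U : GaugeConfig d L G => f (wordHolonomy U x w)) S := by
  intro U V hUV
  simp only
  rw [wordHolonomy_congr x w fun k hk => hUV _ (h k hk)]

end Support

namespace Word

variable {d : ℕ} [NeZero d]

omit [NeZero d] in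
/-- Displacement of a reflected step. [folklore] -/
theorem disp_reflect0 [NeZero d] (s : Step d) (k : Fin d) :
    (s.reflect0).disp k = if k = 0 then -s.disp k else s.disp k := by
  cases s with
  | fwd μ =>
    by_cases hμ : μ = 0
    · subst hμ; by_cases hk : k = 0 <;> simp [Step.reflect0, Step.disp, hk]
    · by_cases hk : k = 0
      · subst hk; simp [Step.reflect0, Step.disp, hμ]
      · simp [Step.reflect0, Step.disp, hμ, hk]
  | bwd μ =>
    by_cases hμ : μ = 0
    · subst hμ; by_cases hk : k = 0 <;> simp [Step.reflect0, Step.disp, hk]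
    · by_cases hk : k = 0
      · subst hk; simp [Step.reflect0, Step.disp, hμ]
      · simp [Step.reflect0, Step.disp, hμ, hk]

/-- Displacement of a reflected word: the time component changes sign. [folklore] -/
theorem disp_map_reflect0 (w : Word d) (k : Fin d) :
    disp (w.map Step.reflect0) k = if k = 0 then -disp w k else disp w k := by
  induction w with
  | nil => simp
  | cons s w ih =>
    simp only [List.map_cons, disp_cons, Pi.add_apply, ih, disp_reflect0]
    split_ifs <;> ring

/-- A closed word stays closed under the reflection of axis `0`. [folklore] -/
theorem disp_map_reflect0_eq_zero {w : Word d} (hw : disp w = 0) : disp (w.map Step.reflect0) = 0 := by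
  funext k
  rw [disp_map_reflect0, hw]
  simp

end Word

/-! ## The site-reflection block for a family of words -/

section SiteBlock

variable {d L N : ℕ} [NeZero d] [NeZero L] {G : Type*} [Group G] [TopologicalSpace G]
  [IsTopologicalGroup G] [CompactSpace G] [MeasurableSpace G] [BorelSpace G]
  (ρ : G →* Matrix (Fin N) (Fin N) ℂ)

omit [NeZero L] [MeasurableSpace G] [BorelSpace G] in
/-- The pairing of matrix entries of the unitarised representation is the character of `A⁻¹B`:
`∑_{kl} conj σ(A)_{kl} σ(B)_{kl} = tr σ(A⁻¹ B)`. [folklore] -/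
theorem sum_conj_mul_unitarize_eq_trace (hρ : Continuous ρ) (A B : G) :
    ∑ kl : Fin N × Fin N, conj (CompactGroup.unitarize ρ hρ A kl.1 kl.2) * CompactGroup.unitarize ρ hρ B kl.1 kl.2 =
      (CompactGroup.unitarize ρ hρ (A⁻¹ * B)).trace := by
  have h := WilsonLoopRP.trace_unitarize_mul_inv ρ hρ B A
  have hconj : (CompactGroup.unitarize ρ hρ (A⁻¹ * B)).trace = (CompactGroup.unitarize ρ hρ (B * A⁻¹)).trace := by
    rw [show A⁻¹ * B = A⁻¹ * (B * A⁻¹) * A⁻¹⁻¹ by group, CompactGroup.trace_conj_eq]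
  rw [hconj, h, Fintype.sum_prod_type]
  exact Finset.sum_congr rfl fun k _ => Finset.sum_congr rfl fun l _ => mul_comm _ _

/-- **The site-reflection block of a family of half-space words is positive semi-definite in expectation.**
For `L` even, any real `β`, continuous `ρ`, closed words `R₁ … Rₙ` at the origin all of whose links lie in the
closed positive half of height `B` with `2B ≤ L` (`Word.siteHalfOK`, decidable), and real coefficients `c`:
`0 ≤ ∑ᵢ ∑ⱼ cᵢ cⱼ ⟨W_0((θ'Rᵢ)⁻¹ · Rⱼ)⟩_β`, where `θ' = Step.reflect0` reverses the time steps (eng1's `site1`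
block: entry `inverse(xflip(R_a)) + R_b`). Osterwalder–Seiler site reflection positivity of the torus Wilson state
(tree `wilsonExpectation_siteReflectionPositive`) applied to the matrix entries of the word holonomies. [folklore] -/
theorem sum_mul_wilsonExpectation_wordLoop_reflect0_nonneg (hL : Even L) (hρ : Continuous ρ) (β : ℝ)
    {n : ℕ} (R : Fin n → Word d) {B : ℕ} (hB : 2 * B ≤ L)
    (hR : ∀ i, Word.siteHalfOK B (R i) 0 = true) (hRc : ∀ i, Word.disp (R i) = 0) (c : Fin n → ℝ) :
    0 ≤ ∑ i, ∑ j, c i * c j *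
      wilsonExpectation ρ β (wordLoop (G := G) ρ (0 : Site d L)
        (Word.reverse ((R i).map Step.reflect0) ++ R j)) := by
  rcases Nat.eq_zero_or_pos N with hN | hN
  · subst hN
    simp [wordLoop, wilsonExpectation]
  set σ := CompactGroup.unitarize ρ hρ with hσdef
  have hσc : Continuous σ := CompactGroup.continuous_unitarize ρ hρ
  haveI := isProbabilityMeasure_wilsonMeasure (d := d) (L := L) (G := G) ρ hρ β
  -- the family `F_{kl} = ∑ⱼ cⱼ σ(hol_0(Rⱼ))_{kl}`
  set F : Fin N × Fin N → GaugeConfig d L G → ℂ :=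
    fun kl U => ∑ j, (c j : ℂ) * σ (wordHolonomy U (0 : Site d L) (R j)) kl.1 kl.2 with hFdef
  have hFm : ∀ kl, Measurable (F kl) := fun kl =>
    Finset.measurable_sum _ fun j _ => ((entryMeasurable_wordHolonomy σ hσc (R j) 0) kl.1 kl.2).const_mul _
  have hFb : ∀ kl U, ‖F kl U‖ ≤ ∑ j, ‖(c j : ℂ)‖ := fun kl U => by
    refine (norm_sum_le _ _).trans (Finset.sum_le_sum fun j _ => ?_)
    rw [norm_mul]
    exact mul_le_of_le_one_right (norm_nonneg _) (CompactGroup.norm_unitarize_apply_le_one ρ hρ _ _ _)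
  have hFdep : ∀ kl, DependsOn (F kl)
      ((WilsonSiteRP.sitePosEdges ∪ WilsonSiteRP.sharedEdges : Finset (Edge d L)) : Set (Edge d L)) := by
    intro kl U V hUV
    refine Finset.sum_congr rfl fun j _ => ?_
    have hdep := dependsOn_wordHolonomy (fun g => σ g kl.1 kl.2) (0 : Site d L) (R j)
      ((WilsonSiteRP.sitePosEdges ∪ WilsonSiteRP.sharedEdges : Finset (Edge d L)) : Set (Edge d L))
      (fun k hk => by
        have h := edge_mem_of_siteHalfOK (d := d) (L := L) hB (R j) 0 (hR j) k hk
        rw [castZ_zero] at h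
        exact Finset.mem_coe.2 h)
    have hUV' := hdep hUV
    simp only at hUV'
    rw [hUV']
  -- positivity of each `⟨conj F_{kl}(Θ'U) F_{kl}(U)⟩`
  have hpos : ∀ kl, 0 ≤ wilsonExpectation ρ β fun U => conj (F kl U.negReflect) * F kl U := fun kl =>
    wilsonExpectation_siteReflectionPositive ρ hL hρ β (F kl) (hFm kl) ⟨_, hFb kl⟩ (hFdep kl)
  -- the entry words
  have hclosed : ∀ i, Word.endpoint (0 : Site d L) ((R i).map Step.reflect0) = 0 := fun i =>
    Word.endpoint_eq_self_of_disp 0 (Word.disp_map_reflect0_eq_zero (hRc i))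
  have hhol : ∀ i j (U : GaugeConfig d L G),
      wordHolonomy U 0 (Word.reverse ((R i).map Step.reflect0) ++ R j) =
        (wordHolonomy U.negReflect 0 (R i))⁻¹ * wordHolonomy U 0 (R j) := by
    intro i j U
    rw [wordHolonomy_append, wordHolonomy_negReflect, negReflect_zero]
    have h1 := wordHolonomy_reverse U (0 : Site d L) ((R i).map Step.reflect0)
    have h2 := Word.endpoint_reverse (0 : Site d L) ((R i).map Step.reflect0)
    rw [hclosed i] at h1 h2
    rw [h1, h2]
  -- the pointwise identity `∑_{kl} conj F_{kl}(Θ'U) F_{kl}(U) = Φ(U)`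
  have hpt : ∀ U : GaugeConfig d L G, (∑ kl : Fin N × Fin N, conj (F kl U.negReflect) * F kl U) =
      ∑ i, ∑ j, (c i * c j : ℂ) *
        (σ (wordHolonomy U 0 (Word.reverse ((R i).map Step.reflect0) ++ R j))).trace := by
    intro U
    have hexp : ∀ kl : Fin N × Fin N, conj (F kl U.negReflect) * F kl U =
        ∑ i, ∑ j, (c i * c j : ℂ) * (conj (σ (wordHolonomy U.negReflect 0 (R i)) kl.1 kl.2) *
          σ (wordHolonomy U 0 (R j)) kl.1 kl.2) := by
      intro kl
      simp only [hFdef, map_sum, map_mul, Complex.conj_ofReal]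
      rw [Finset.sum_mul]
      refine Finset.sum_congr rfl fun i _ => ?_
      rw [Finset.mul_sum]
      exact Finset.sum_congr rfl fun j _ => by ring
    simp_rw [hexp]
    rw [Finset.sum_comm]
    refine Finset.sum_congr rfl fun i _ => ?_
    rw [Finset.sum_comm]
    refine Finset.sum_congr rfl fun j _ => ?_
    rw [← Finset.mul_sum, hhol, ← sum_conj_mul_unitarize_eq_trace ρ hρ]
  -- integrability and the real part
  have htm : ∀ i j, Measurable fun U : GaugeConfig d L G =>
      (σ (wordHolonomy U 0 (Word.reverse ((R i).map Step.reflect0) ++ R j))).trace := fun i j =>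
    (entryMeasurable_wordHolonomy σ hσc _ 0).measurable_trace
  have htb : ∀ i j (U : GaugeConfig d L G),
      ‖(σ (wordHolonomy U 0 (Word.reverse ((R i).map Step.reflect0) ++ R j))).trace‖ ≤ N := fun i j U => by
    rw [Matrix.trace]
    refine (norm_sum_le _ _).trans ?_
    calc ∑ k, ‖Matrix.diag (σ (wordHolonomy U 0 (Word.reverse ((R i).map Step.reflect0) ++ R j))) k‖
        ≤ ∑ _k : Fin N, (1 : ℝ) := Finset.sum_le_sum fun k _ => CompactGroup.norm_unitarize_apply_le_one ρ hρ _ k k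
      _ = N := by simp
  have hint : ∀ i j, Integrable (fun U : GaugeConfig d L G => (c i * c j : ℂ) *
      (σ (wordHolonomy U 0 (Word.reverse ((R i).map Step.reflect0) ++ R j))).trace) (wilsonMeasure ρ β) :=
    fun i j => (Integrable.of_bound (μ := wilsonMeasure ρ β) (htm i j).aestronglyMeasurable _
      (ae_of_all _ (htb i j))).const_mul _
  have hintF : ∀ kl, Integrable (fun U : GaugeConfig d L G => conj (F kl U.negReflect) * F kl U)
      (wilsonMeasure ρ β) := by
    intro kl
    have hm : Measurable fun U : GaugeConfig d L G => conj (F kl U.negReflect) * F kl U :=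
      ((Complex.continuous_conj.measurable.comp ((hFm kl).comp
        (WilsonSiteRP.measurePreserving_negReflect (d := d) (L := L) (G := G)).measurable)).mul (hFm kl))
    refine Integrable.of_bound (μ := wilsonMeasure ρ β) hm.aestronglyMeasurable ((∑ j, ‖(c j : ℂ)‖) * ∑ j, ‖(c j : ℂ)‖)
      (ae_of_all _ fun U => ?_)
    rw [norm_mul, Complex.norm_conj]
    exact mul_le_mul (hFb kl U.negReflect) (hFb kl U) (norm_nonneg _)
      ((norm_nonneg (F kl U.negReflect)).trans (hFb kl U.negReflect))
  -- `0 ≤ ⟨Φ⟩` in `ℂ`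
  have hΦ : 0 ≤ wilsonExpectation ρ β fun U : GaugeConfig d L G => ∑ i, ∑ j, (c i * c j : ℂ) *
      (σ (wordHolonomy U 0 (Word.reverse ((R i).map Step.reflect0) ++ R j))).trace := by
    have : (wilsonExpectation ρ β fun U : GaugeConfig d L G => ∑ i, ∑ j, (c i * c j : ℂ) *
        (σ (wordHolonomy U 0 (Word.reverse ((R i).map Step.reflect0) ++ R j))).trace) =
        ∑ kl : Fin N × Fin N, wilsonExpectation ρ β fun U => conj (F kl U.negReflect) * F kl U := by
      unfold wilsonExpectation
      rw [← integral_finsetSum _ fun kl _ => hintF kl]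
      exact integral_congr_ae (ae_of_all _ fun U => (hpt U).symm)
    rw [this]
    exact Finset.sum_nonneg fun kl _ => hpos kl
  -- take the real part
  have hre : (wilsonExpectation ρ β fun U : GaugeConfig d L G => ∑ i, ∑ j, (c i * c j : ℂ) *
      (σ (wordHolonomy U 0 (Word.reverse ((R i).map Step.reflect0) ++ R j))).trace).re =
      N * ∑ i, ∑ j, c i * c j *
        wilsonExpectation ρ β (wordLoop (G := G) ρ (0 : Site d L) (Word.reverse ((R i).map Step.reflect0) ++ R j)) := by
    unfold wilsonExpectation
    rw [integral_finsetSum _ fun i _ => integrable_finsetSum _ fun j _ => hint i j, Complex.re_sum, Finset.mul_sum]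
    refine Finset.sum_congr rfl fun i _ => ?_
    rw [integral_finsetSum _ fun j _ => hint i j, Complex.re_sum, Finset.mul_sum]
    refine Finset.sum_congr rfl fun j _ => ?_
    rw [integral_const_mul, ← Complex.ofReal_mul, Complex.re_ofReal_mul]
    have hI := integral_re (Integrable.of_bound (μ := wilsonMeasure ρ β) (htm i j).aestronglyMeasurable _
      (ae_of_all _ (htb i j)))
    simp only [RCLike.re_to_complex] at hI
    have hN' : (N : ℝ) ≠ 0 := Nat.cast_ne_zero.2 hN.ne'
    have hpt2 : (fun U : GaugeConfig d L G =>
        ((σ (wordHolonomy U 0 (Word.reverse ((R i).map Step.reflect0) ++ R j))).trace).re) =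
        fun U => (N : ℝ) * wordLoop ρ (0 : Site d L) (Word.reverse ((R i).map Step.reflect0) ++ R j) U := by
      funext U
      rw [hσdef, CompactGroup.trace_unitarize, wordLoop_apply, mul_inv_cancel_left₀ hN']
    rw [← hI, hpt2, integral_const_mul]
    ring
  have h0 := (Complex.nonneg_iff.1 hΦ).1
  rw [hre] at h0
  exact nonneg_of_mul_nonneg_right (by simpa using h0) (Nat.cast_pos.2 hN)

end SiteBlock

end Summit.QuantumFields.GaugeBoot

end
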